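import Literature.Probability.Distributions.GaussianSphereMarginalTV

/-!
# NE9GaussDensityRay — the Gaussian density with a MEAN along rays: the radial derivative of `r ↦ r^m φ_μ(r•w)`, its
dominating function, the fundamental theorem of calculus along a ray, and three Gaussian integrals (support file for
`NE9RadialShellMean`; cell `pub-balaban`, T4-DAG §2 node U3 / §6 NE9; lineage t4-ne9-p1 = prover P1, generation 21)

HONEST FRAMING (T4-DAG PAGE 1).  Rung (B)+1 on a FIXED finite torus with `FlowStep.BetaPertH` and (B) explicit — NOT
infinite volume, NOT a mass gap, NOT the Clay problem.  This module is elementary calculus / Gaussian measure theory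
(`[folklore]`); nothing of [Balaban1987RG1]/[Balaban1988RG2Cluster] is asserted or cited as a fact.  NOT summit progress.

WHAT IS PROVED (kernel).  With `φ_μ(y) = (2π)^{−m/2} e^{−‖y − μ‖²/2}` (`gaussDensity`, `m = dim F`):
§1 `hasDerivAt_rayDensity`: `d/dr [r^m φ_μ(r•w)] = (2π)^{−m/2}e^{−‖r•w−μ‖²/2}(m r^{m−1} − r^m⟨w, r•w − μ⟩)` (the exponent is a
   polynomial in `r`, `rayExp_eq`); `deriv_le_rayBound`: it is dominated for `r ≥ 0` by
   `hb(r, w) = r^{m−1} φ_μ(r•w) (m + r‖w‖‖r•w − μ‖)` (`rayBound`; Cauchy–Schwarz); `rayDensity_sub_le_integral`: the FTC along the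
   ray, `a′^m φ_μ(a′•w) − a^m φ_μ(a•w) ≤ ∫_a^{a′} hb(r, w) dr` for `0 ≤ a ≤ a′`.
§2 `lintegral_gaussDensity` (`∫ φ_μ = 1`, density of the standard Gaussian + translation), `lintegral_norm_mul_gaussDensity_le`
   (`∫ ‖y − μ‖ φ_μ(y) dy ≤ 2^{m/2}`, from `s e^{−s²/2} ≤ e^{−s²/4}` and the Gaussian integral at variance 2),
   `setLIntegral_gaussDensity_ball_le` (`∫_{B_r} φ_μ ≤ r (1 + (2π)^{−m/2} vol B₁)` for `r > 0`).
§3 `setLIntegral_ball_eq_smul` (scaling `∫_{B_r} G = ∫_{B₁} r^m G(r•w) dw`), **`setLIntegral_rayBound_le`**: for every `r > 0`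
   and every mean, `∫_{B₁} hb(r, w) dw ≤ K′_m = m(1 + (2π)^{−m/2} vol B₁) + 2^{m/2}` (`meanShellConst`) — the per-radius bound
   that makes the shell estimate uniform in the mean; `setLIntegral_gaussDensity_ball_eq`, `continuous_rayBound_uncurry`.
These are the inputs of the uniform-in-the-mean radial shell bound of `NE9RadialShellMean` (residual line (R-9) of row NE9).
-/

noncomputable section

namespace Summit.QuantumFields.BalabanUV.T4Continuum.NE9GaussDensityRay

open MeasureTheory ProbabilityTheory Set Real Module Metric
open scoped ENNReal RealInnerProductSpace
open Literature.Probability.Distributions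

section Elementary

variable {F : Type*} [NormedAddCommGroup F] [InnerProductSpace ℝ F]

/-! ## §1 The Gaussian density with a mean; elementary bounds; the radial derivative -/

/-- The normalising constant `(2π)^{−m/2}`, `m = dim F`. [folklore] -/
def gaussConst (F : Type*) [NormedAddCommGroup F] [InnerProductSpace ℝ F] : ℝ :=
  (2 * π) ^ (-(finrank ℝ F : ℝ) / 2)

/-- `(2π)^{−m/2} > 0`. [folklore] -/
theorem gaussConst_pos : 0 < gaussConst F := by
  unfold gaussConst; positivity

/-- The Gaussian density with mean `μ` and unit covariance: `φ_μ(y) = (2π)^{−m/2}·e^{−‖y − μ‖²/2}`. [folklore] -/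
def gaussDensity (μ y : F) : ℝ := gaussConst F * rexp (-‖y - μ‖ ^ 2 / 2)

/-- `φ_μ > 0`. [folklore] -/
theorem gaussDensity_pos (μ y : F) : 0 < gaussDensity μ y :=
  mul_pos gaussConst_pos (Real.exp_pos _)

/-- `φ_μ ≤ (2π)^{−m/2}`. [folklore] -/
theorem gaussDensity_le (μ y : F) : gaussDensity μ y ≤ gaussConst F := by
  unfold gaussDensity
  have : rexp (-‖y - μ‖ ^ 2 / 2) ≤ 1 := Real.exp_le_one_iff.2 (by nlinarith [sq_nonneg ‖y - μ‖])
  nlinarith [gaussConst_pos (F := F)]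

/-- `φ_μ` is continuous. [folklore] -/
theorem continuous_gaussDensity (μ : F) : Continuous (gaussDensity μ) := by
  unfold gaussDensity; fun_prop

/-- `s·e^{−s²/2} ≤ e^{−s²/4}` (from `s ≤ 1 + s²/4 ≤ e^{s²/4}`). [folklore] -/
theorem mul_exp_neg_sq_half_le (s : ℝ) : s * rexp (-s ^ 2 / 2) ≤ rexp (-s ^ 2 / 4) := by
  have h1 : s ≤ rexp (s ^ 2 / 4) := by
    have := Real.add_one_le_exp (s ^ 2 / 4)
    nlinarith [sq_nonneg (s - 2)]
  calc s * rexp (-s ^ 2 / 2) ≤ rexp (s ^ 2 / 4) * rexp (-s ^ 2 / 2) :=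
        mul_le_mul_of_nonneg_right h1 (Real.exp_pos _).le
    _ = rexp (-s ^ 2 / 4) := by rw [← Real.exp_add]; ring_nf

/-- `s·e^{−s²/2} ≤ 1`. [folklore] -/
theorem mul_exp_neg_sq_half_le_one (s : ℝ) : s * rexp (-s ^ 2 / 2) ≤ 1 :=
  (mul_exp_neg_sq_half_le s).trans (Real.exp_le_one_iff.2 (by nlinarith [sq_nonneg s]))

/-- `‖y − μ‖·φ_μ(y) ≤ (2π)^{−m/2}·e^{−‖y − μ‖²/4}`. [folklore] -/
theorem norm_mul_gaussDensity_le (μ y : F) :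
    ‖y - μ‖ * gaussDensity μ y ≤ gaussConst F * rexp (-‖y - μ‖ ^ 2 / 4) := by
  unfold gaussDensity
  calc ‖y - μ‖ * (gaussConst F * rexp (-‖y - μ‖ ^ 2 / 2))
      = gaussConst F * (‖y - μ‖ * rexp (-‖y - μ‖ ^ 2 / 2)) := by ring
    _ ≤ gaussConst F * rexp (-‖y - μ‖ ^ 2 / 4) :=
        mul_le_mul_of_nonneg_left (mul_exp_neg_sq_half_le _) gaussConst_pos.le

/-- `‖y − μ‖·φ_μ(y) ≤ (2π)^{−m/2}`. [folklore] -/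
theorem norm_mul_gaussDensity_le_const (μ y : F) : ‖y - μ‖ * gaussDensity μ y ≤ gaussConst F := by
  unfold gaussDensity
  calc ‖y - μ‖ * (gaussConst F * rexp (-‖y - μ‖ ^ 2 / 2))
      = gaussConst F * (‖y - μ‖ * rexp (-‖y - μ‖ ^ 2 / 2)) := by ring
    _ ≤ gaussConst F * 1 := mul_le_mul_of_nonneg_left (mul_exp_neg_sq_half_le_one _) gaussConst_pos.le
    _ = gaussConst F := mul_one _

/-- The exponent along a ray, as a polynomial in `r`: `q(r) = −(r²‖w‖² − 2r⟨w,μ⟩ + ‖μ‖²)/2`. [folklore] -/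
def rayExp (μ w : F) (r : ℝ) : ℝ := -(r ^ 2 * ‖w‖ ^ 2 - 2 * r * ⟪w, μ⟫ + ‖μ‖ ^ 2) / 2

/-- `q(r) = −‖r•w − μ‖²/2`. [folklore] -/
theorem rayExp_eq (μ w : F) (r : ℝ) : rayExp μ w r = -‖r • w - μ‖ ^ 2 / 2 := by
  unfold rayExp
  rw [norm_sub_sq_real, norm_smul, real_inner_smul_left, Real.norm_eq_abs, mul_pow, sq_abs]
  ring

/-- `φ_μ(r•w) = (2π)^{−m/2}·e^{q(r)}`. [folklore] -/
theorem gaussDensity_smul_eq (μ w : F) (r : ℝ) : gaussDensity μ (r • w) = gaussConst F * rexp (rayExp μ w r) := by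
  rw [gaussDensity, rayExp_eq]

/-- `⟨w, r•w − μ⟩ = r‖w‖² − ⟨w, μ⟩`. [folklore] -/
theorem inner_smul_sub (μ w : F) (r : ℝ) : ⟪w, r • w - μ⟫ = r * ‖w‖ ^ 2 - ⟪w, μ⟫ := by
  rw [inner_sub_right, real_inner_smul_right, real_inner_self_eq_norm_sq]

/-- The scaled density along a ray `ψ(r) = r^m·φ_μ(r•w)` (in polynomial form) and its `r`-derivative
`ψ′(r) = (2π)^{−m/2}e^{q(r)}·(m·r^{m−1} − r^m·⟨w, r•w − μ⟩)`. [folklore] -/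
theorem hasDerivAt_rayDensity (μ w : F) (m : ℕ) (r : ℝ) :
    HasDerivAt (fun r => r ^ m * (gaussConst F * rexp (rayExp μ w r)))
      (gaussConst F * rexp (rayExp μ w r) * ((m : ℝ) * r ^ (m - 1) - r ^ m * ⟪w, r • w - μ⟫)) r := by
  have h1 : HasDerivAt (fun r : ℝ => r ^ 2 * ‖w‖ ^ 2 - 2 * r * ⟪w, μ⟫ + ‖μ‖ ^ 2)
      (((2 : ℕ) : ℝ) * r ^ (2 - 1) * ‖w‖ ^ 2 - 2 * 1 * ⟪w, μ⟫) r :=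
    (((hasDerivAt_pow 2 r).mul_const _).sub (((hasDerivAt_id r).const_mul 2).mul_const _)).add_const _
  have hq : HasDerivAt (rayExp μ w) (-(r * ‖w‖ ^ 2 - ⟪w, μ⟫)) r := by
    show HasDerivAt (fun r : ℝ => -(r ^ 2 * ‖w‖ ^ 2 - 2 * r * ⟪w, μ⟫ + ‖μ‖ ^ 2) / 2) _ r
    refine (h1.neg.div_const 2).congr_deriv ?_
    push_cast
    ring
  have hexp : HasDerivAt (fun r => gaussConst F * rexp (rayExp μ w r))
      (gaussConst F * (rexp (rayExp μ w r) * -(r * ‖w‖ ^ 2 - ⟪w, μ⟫))) r :=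
    (hq.exp).const_mul _
  have hpow : HasDerivAt (fun r : ℝ => r ^ m) ((m : ℝ) * r ^ (m - 1)) r := hasDerivAt_pow m r
  refine (hpow.mul hexp).congr_deriv ?_
  rw [inner_smul_sub]
  ring

/-- The dominating function of the radial derivative: `hb(r) = r^{m−1}·φ_μ(r•w)·(m + r·‖w‖·‖r•w − μ‖)`. [folklore] -/
def rayBound (μ w : F) (m : ℕ) (r : ℝ) : ℝ :=
  r ^ (m - 1) * gaussDensity μ (r • w) * ((m : ℝ) + r * (‖w‖ * ‖r • w - μ‖))

/-- `hb ≥ 0` for `r ≥ 0`. [folklore] -/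
theorem rayBound_nonneg (μ w : F) (m : ℕ) {r : ℝ} (hr : 0 ≤ r) : 0 ≤ rayBound μ w m r := by
  unfold rayBound
  have := gaussDensity_pos μ (r • w)
  positivity

/-- `hb` is continuous in `r`. [folklore] -/
theorem continuous_rayBound (μ w : F) (m : ℕ) : Continuous (rayBound μ w m) := by
  unfold rayBound gaussDensity
  fun_prop

/-- `|ψ′(r)| ≤ hb(r)` for `r ≥ 0`, `m ≥ 1` (Cauchy–Schwarz on `⟨w, r•w − μ⟩`). [folklore] -/
theorem deriv_le_rayBound (μ w : F) {m : ℕ} (hm : 1 ≤ m) {r : ℝ} (hr : 0 ≤ r) :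
    gaussConst F * rexp (rayExp μ w r) * ((m : ℝ) * r ^ (m - 1) - r ^ m * ⟪w, r • w - μ⟫) ≤ rayBound μ w m r := by
  rw [rayBound, gaussDensity_smul_eq]
  have hφ : 0 < gaussConst F * rexp (rayExp μ w r) := mul_pos gaussConst_pos (Real.exp_pos _)
  have hcs : -(r ^ m * ⟪w, r • w - μ⟫) ≤ r ^ m * (‖w‖ * ‖r • w - μ‖) := by
    have h1 : |⟪w, r • w - μ⟫| ≤ ‖w‖ * ‖r • w - μ‖ := abs_real_inner_le_norm _ _
    have h2 : -⟪w, r • w - μ⟫ ≤ ‖w‖ * ‖r • w - μ‖ := (neg_le_abs _).trans h1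
    calc -(r ^ m * ⟪w, r • w - μ⟫) = r ^ m * -⟪w, r • w - μ⟫ := by ring
      _ ≤ r ^ m * (‖w‖ * ‖r • w - μ‖) := mul_le_mul_of_nonneg_left h2 (pow_nonneg hr _)
  have hpm : r ^ m = r ^ (m - 1) * r := by
    rw [← pow_succ, Nat.sub_add_cancel hm]
  calc gaussConst F * rexp (rayExp μ w r) * ((m : ℝ) * r ^ (m - 1) - r ^ m * ⟪w, r • w - μ⟫)
      ≤ gaussConst F * rexp (rayExp μ w r) * ((m : ℝ) * r ^ (m - 1) + r ^ m * (‖w‖ * ‖r • w - μ‖)) := by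
        apply mul_le_mul_of_nonneg_left _ hφ.le
        linarith
    _ = r ^ (m - 1) * (gaussConst F * rexp (rayExp μ w r)) * ((m : ℝ) + r * (‖w‖ * ‖r • w - μ‖)) := by
        rw [hpm]; ring

/-- **FTC along a ray**: for `0 ≤ a ≤ a′` and `m ≥ 1`,
`a′^m·φ_μ(a′•w) − a^m·φ_μ(a•w) ≤ ∫_a^{a′} hb(r) dr`. [folklore] -/
theorem rayDensity_sub_le_integral (μ w : F) {m : ℕ} (hm : 1 ≤ m) {a a' : ℝ} (ha : 0 ≤ a) (haa : a ≤ a') :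
    a' ^ m * gaussDensity μ (a' • w) - a ^ m * gaussDensity μ (a • w) ≤ ∫ r in a..a', rayBound μ w m r := by
  have hcont : Continuous fun r => gaussConst F * rexp (rayExp μ w r) *
      ((m : ℝ) * r ^ (m - 1) - r ^ m * ⟪w, r • w - μ⟫) := by
    unfold rayExp
    fun_prop
  have hftc := intervalIntegral.integral_eq_sub_of_hasDerivAt
    (fun r _ => hasDerivAt_rayDensity μ w m r) (hcont.intervalIntegrable a a')
  simp only [gaussDensity_smul_eq]
  rw [← hftc]
  refine intervalIntegral.integral_mono_on haa (hcont.intervalIntegrable a a')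
    ((continuous_rayBound μ w m).intervalIntegrable a a') fun r hr => ?_
  exact deriv_le_rayBound μ w hm (ha.trans hr.1)

end Elementary

section MeasureBounds

variable {F : Type*} [NormedAddCommGroup F] [InnerProductSpace ℝ F] [FiniteDimensional ℝ F] [MeasurableSpace F]
  [BorelSpace F]

/-! ## §2 Three Gaussian integrals: total mass, first absolute moment, small balls -/

/-- `∫ φ_μ = 1` (density of the standard Gaussian, translated). [folklore] -/
theorem lintegral_gaussDensity (μ : F) : ∫⁻ y, ENNReal.ofReal (gaussDensity μ y) = 1 := by
  have h := lintegral_stdGaussian_eq_lintegral_mul (E := F) (g := fun _ => (1 : ℝ≥0∞)) measurable_const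
  rw [lintegral_const, measure_univ, mul_one] at h
  have ht := lintegral_sub_right_eq_self (μ := (volume : Measure F))
    (fun x : F => ENNReal.ofReal ((2 * π) ^ (-(finrank ℝ F : ℝ) / 2) * rexp (-‖x‖ ^ 2 / 2))) μ
  simp only [mul_one] at h
  unfold gaussDensity gaussConst
  rw [ht]
  exact h.symm

/-- `∫ ‖y − μ‖·φ_μ(y) dy ≤ 2^{m/2}` (`s e^{−s²/2} ≤ e^{−s²/4}`, translation, the Gaussian integral at variance 2:
tree `lintegral_gaussianConst_mul_exp_neg_quarter`). [folklore] -/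
theorem lintegral_norm_mul_gaussDensity_le (μ : F) :
    ∫⁻ y, ENNReal.ofReal (‖y - μ‖ * gaussDensity μ y) ≤ ENNReal.ofReal ((2 : ℝ) ^ ((finrank ℝ F : ℝ) / 2)) := by
  have ht := lintegral_sub_right_eq_self (μ := (volume : Measure F))
    (fun x : F => ENNReal.ofReal ((2 * π) ^ (-(finrank ℝ F : ℝ) / 2) * rexp (-(1 / 4) * ‖x‖ ^ 2))) μ
  calc ∫⁻ y, ENNReal.ofReal (‖y - μ‖ * gaussDensity μ y)
      ≤ ∫⁻ y, ENNReal.ofReal ((2 * π) ^ (-(finrank ℝ F : ℝ) / 2) * rexp (-(1 / 4) * ‖y - μ‖ ^ 2)) := by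
        refine lintegral_mono fun y => ENNReal.ofReal_le_ofReal ?_
        have h := norm_mul_gaussDensity_le μ y
        rw [show -(1 / 4) * ‖y - μ‖ ^ 2 = -‖y - μ‖ ^ 2 / 4 by ring]
        exact h
    _ = ∫⁻ y, ENNReal.ofReal ((2 * π) ^ (-(finrank ℝ F : ℝ) / 2) * rexp (-(1 / 4) * ‖y‖ ^ 2)) := ht
    _ = ENNReal.ofReal ((2 : ℝ) ^ ((finrank ℝ F : ℝ) / 2)) := lintegral_gaussianConst_mul_exp_neg_quarter

/-- The ball constant `(2π)^{−m/2}·vol(B₁)`. [folklore] -/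
def ballConst (F : Type*) [NormedAddCommGroup F] [InnerProductSpace ℝ F] [FiniteDimensional ℝ F] [MeasurableSpace F]
    [BorelSpace F] : ℝ :=
  gaussConst F * (volume : Measure F).real (ball 0 1)

/-- `(2π)^{−m/2}·vol(B₁) ≥ 0`. [folklore] -/
theorem ballConst_nonneg : 0 ≤ ballConst F :=
  mul_nonneg gaussConst_pos.le measureReal_nonneg

/-- `∫_{B_r} φ_μ ≤ r·(1 + (2π)^{−m/2}vol(B₁))` for `r > 0`: by the total mass for `r ≥ 1`, by `φ_μ ≤ (2π)^{−m/2}` and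
`vol(B_r) = r^m vol(B₁) ≤ r·vol(B₁)` for `r ≤ 1`. [folklore] -/
theorem setLIntegral_gaussDensity_ball_le [Nontrivial F] (μ : F) {r : ℝ} (hr : 0 < r) :
    ∫⁻ y in ball (0 : F) r, ENNReal.ofReal (gaussDensity μ y) ≤ ENNReal.ofReal (r * (1 + ballConst F)) := by
  by_cases h1 : r ≤ 1
  · have hball : (volume : Measure F) (ball 0 r) =
        ENNReal.ofReal (r ^ finrank ℝ F) * ENNReal.ofReal ((volume : Measure F).real (ball 0 1)) := by
      rw [Measure.addHaar_ball_of_pos _ _ hr, measureReal_def, ENNReal.ofReal_toReal measure_ball_lt_top.ne]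
    have hpow : r ^ finrank ℝ F ≤ r := by
      calc r ^ finrank ℝ F ≤ r ^ 1 := pow_le_pow_of_le_one hr.le h1 Module.finrank_pos
        _ = r := pow_one r
    calc ∫⁻ y in ball (0 : F) r, ENNReal.ofReal (gaussDensity μ y)
        ≤ ∫⁻ y in ball (0 : F) r, ENNReal.ofReal (gaussConst F) :=
          setLIntegral_mono measurable_const fun y _ => ENNReal.ofReal_le_ofReal (gaussDensity_le μ y)
      _ = ENNReal.ofReal (gaussConst F) * (ENNReal.ofReal (r ^ finrank ℝ F) *
            ENNReal.ofReal ((volume : Measure F).real (ball 0 1))) := by rw [setLIntegral_const, hball]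
      _ = ENNReal.ofReal (r ^ finrank ℝ F * ballConst F) := by
          rw [ballConst, ENNReal.ofReal_mul (pow_nonneg hr.le _), ENNReal.ofReal_mul gaussConst_pos.le]
          ring
      _ ≤ ENNReal.ofReal (r * (1 + ballConst F)) := by
          refine ENNReal.ofReal_le_ofReal ?_
          have hb := ballConst_nonneg (F := F)
          nlinarith [mul_le_mul_of_nonneg_right hpow hb]
  · have h1 : 1 < r := not_le.1 h1
    calc ∫⁻ y in ball (0 : F) r, ENNReal.ofReal (gaussDensity μ y) ≤ ∫⁻ y, ENNReal.ofReal (gaussDensity μ y) :=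
          setLIntegral_le_lintegral _ _
      _ = 1 := lintegral_gaussDensity μ
      _ ≤ ENNReal.ofReal (r * (1 + ballConst F)) := by
          rw [← ENNReal.ofReal_one]
          refine ENNReal.ofReal_le_ofReal ?_
          have hb := ballConst_nonneg (F := F)
          nlinarith

end MeasureBounds

section Shell

variable {F : Type*} [NormedAddCommGroup F] [InnerProductSpace ℝ F] [FiniteDimensional ℝ F] [MeasurableSpace F]
  [BorelSpace F]

/-! ## §3 Scaling to the unit ball and the per-radius bound (uniform in the mean) -/

/-- The uniform shell constant `K′_m = m·(1 + (2π)^{−m/2}vol(B₁)) + 2^{m/2}`. [folklore] -/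
def meanShellConst (F : Type*) [NormedAddCommGroup F] [InnerProductSpace ℝ F] [FiniteDimensional ℝ F]
    [MeasurableSpace F] [BorelSpace F] : ℝ :=
  finrank ℝ F * (1 + ballConst F) + (2 : ℝ) ^ ((finrank ℝ F : ℝ) / 2)

/-- `K′_m ≥ 0`. [folklore] -/
theorem meanShellConst_nonneg : 0 ≤ meanShellConst F := by
  unfold meanShellConst
  have := ballConst_nonneg (F := F)
  positivity

omit [FiniteDimensional ℝ F] [MeasurableSpace F] [BorelSpace F] in
/-- `r • w ∈ B_r ↔ w ∈ B₁` for `r > 0`. [folklore] -/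
theorem smul_mem_ball_iff {r : ℝ} (hr : 0 < r) (w : F) : r • w ∈ ball (0 : F) r ↔ w ∈ ball (0 : F) 1 := by
  rw [mem_ball_zero_iff, mem_ball_zero_iff, norm_smul, Real.norm_eq_abs, abs_of_pos hr]
  constructor
  · intro h; nlinarith
  · intro h; nlinarith

/-- **Scaling to the unit ball**: for `r > 0` and any `G`,
`∫_{B_r} G(y) dy = ∫_{B₁} r^m·G(r•w) dw` (lower integrals). [folklore] -/
theorem setLIntegral_ball_eq_smul {r : ℝ} (hr : 0 < r) (G : F → ℝ≥0∞) :
    ∫⁻ y in ball (0 : F) r, G y = ∫⁻ w in ball (0 : F) 1, ENNReal.ofReal (r ^ finrank ℝ F) * G (r • w) := by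
  rw [← lintegral_indicator measurableSet_ball, ← lintegral_indicator measurableSet_ball]
  have hpt : ∀ w : F, (ball (0 : F) 1).indicator (fun w => ENNReal.ofReal (r ^ finrank ℝ F) * G (r • w)) w =
      ENNReal.ofReal (r ^ finrank ℝ F) * (ball (0 : F) r).indicator G (r • w) := by
    intro w
    by_cases hw : w ∈ ball (0 : F) 1
    · rw [indicator_of_mem hw, indicator_of_mem ((smul_mem_ball_iff hr w).2 hw)]
    · have hw' : r • w ∉ ball (0 : F) r := fun h => hw ((smul_mem_ball_iff hr w).1 h)
      rw [indicator_of_notMem hw, indicator_of_notMem hw', mul_zero]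
  simp_rw [hpt]
  rw [lintegral_const_mul' _ _ ENNReal.ofReal_ne_top, lintegral_comp_smul _ hr.ne', ← mul_assoc,
    ← ENNReal.ofReal_mul (pow_nonneg hr.le _), abs_of_pos (inv_pos.2 (pow_pos hr _)),
    mul_inv_cancel₀ (pow_pos hr _).ne', ENNReal.ofReal_one, one_mul]

/-- **The per-radius bound** (the heart of the uniformity in the mean): for `r > 0`,
`∫_{B₁} hb(r, w) dw ≤ K′_m` — after scaling back to `B_r` the integrand is `r^{−1}·φ_μ(y)·(m + r‖y − μ‖)` with
`‖y‖ < r`, and `m·r^{−1}∫_{B_r}φ_μ ≤ m(1 + (2π)^{−m/2}vol B₁)`, `∫‖y − μ‖φ_μ ≤ 2^{m/2}`. [folklore] -/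
theorem setLIntegral_rayBound_le [Nontrivial F] (μ : F) {r : ℝ} (hr : 0 < r) :
    ∫⁻ w in ball (0 : F) 1, ENNReal.ofReal (rayBound μ w (finrank ℝ F) r) ≤ ENNReal.ofReal (meanShellConst F) := by
  set m : ℕ := finrank ℝ F with hm
  have hm1 : 1 ≤ m := Module.finrank_pos
  -- the integrand on B_r after scaling back
  set G : F → ℝ≥0∞ := fun y => ENNReal.ofReal (r⁻¹ * (gaussDensity μ y * ((m : ℝ) + r * ‖y - μ‖))) with hG
  -- (i) pointwise on B₁: hb ≤ r^m · G(r•w)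
  have hpt : ∀ w ∈ ball (0 : F) 1,
      ENNReal.ofReal (rayBound μ w m r) ≤ ENNReal.ofReal (r ^ m) * G (r • w) := by
    intro w hw
    rw [hG, ← ENNReal.ofReal_mul (pow_nonneg hr.le _)]
    refine ENNReal.ofReal_le_ofReal ?_
    have hw1 : ‖w‖ ≤ 1 := (mem_ball_zero_iff.1 hw).le
    have hφ := (gaussDensity_pos μ (r • w)).le
    have hn : 0 ≤ ‖r • w - μ‖ := norm_nonneg _
    have hpm : r ^ m = r ^ (m - 1) * r := by rw [← pow_succ, Nat.sub_add_cancel hm1]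
    unfold rayBound
    rw [hpm]
    have h1 : r * (‖w‖ * ‖r • w - μ‖) ≤ r * ‖r • w - μ‖ := by
      refine mul_le_mul_of_nonneg_left ?_ hr.le
      calc ‖w‖ * ‖r • w - μ‖ ≤ 1 * ‖r • w - μ‖ := mul_le_mul_of_nonneg_right hw1 hn
        _ = ‖r • w - μ‖ := one_mul _
    calc r ^ (m - 1) * gaussDensity μ (r • w) * ((m : ℝ) + r * (‖w‖ * ‖r • w - μ‖))
        ≤ r ^ (m - 1) * gaussDensity μ (r • w) * ((m : ℝ) + r * ‖r • w - μ‖) := by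
          gcongr
      _ = r ^ (m - 1) * r * (r⁻¹ * (gaussDensity μ (r • w) * ((m : ℝ) + r * ‖r • w - μ‖))) := by
          field_simp
  -- (ii) the bound on B_r
  have hGm : ∫⁻ y in ball (0 : F) r, G y ≤ ENNReal.ofReal (meanShellConst F) := by
    have hsplit : ∀ y, G y = ENNReal.ofReal (r⁻¹ * (m : ℝ)) * ENNReal.ofReal (gaussDensity μ y) +
        ENNReal.ofReal (‖y - μ‖ * gaussDensity μ y) := by
      intro y
      have hφ := (gaussDensity_pos μ y).le
      rw [hG, ← ENNReal.ofReal_mul (by positivity), ← ENNReal.ofReal_add (by positivity) (by positivity)]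
      field_simp
    simp_rw [hsplit]
    rw [lintegral_add_left (((continuous_gaussDensity μ).measurable.ennreal_ofReal).const_mul _)]
    rw [lintegral_const_mul _ (continuous_gaussDensity μ).measurable.ennreal_ofReal]
    calc ENNReal.ofReal (r⁻¹ * (m : ℝ)) * (∫⁻ y in ball (0 : F) r, ENNReal.ofReal (gaussDensity μ y)) +
          ∫⁻ y in ball (0 : F) r, ENNReal.ofReal (‖y - μ‖ * gaussDensity μ y)
        ≤ ENNReal.ofReal (r⁻¹ * (m : ℝ)) * ENNReal.ofReal (r * (1 + ballConst F)) +
          ENNReal.ofReal ((2 : ℝ) ^ ((finrank ℝ F : ℝ) / 2)) := by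
          gcongr
          · exact setLIntegral_gaussDensity_ball_le μ hr
          · exact (setLIntegral_le_lintegral _ _).trans (lintegral_norm_mul_gaussDensity_le μ)
      _ = ENNReal.ofReal (meanShellConst F) := by
          rw [← ENNReal.ofReal_mul (by positivity), meanShellConst, ← hm,
            ← ENNReal.ofReal_add (by have := ballConst_nonneg (F := F); positivity) (by positivity)]
          congr 1
          field_simp
  -- assemble with the scaling identity
  calc ∫⁻ w in ball (0 : F) 1, ENNReal.ofReal (rayBound μ w m r)
      ≤ ∫⁻ w in ball (0 : F) 1, ENNReal.ofReal (r ^ m) * G (r • w) := setLIntegral_mono' measurableSet_ball hpt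
    _ = ∫⁻ y in ball (0 : F) r, G y := (setLIntegral_ball_eq_smul hr G).symm
    _ ≤ ENNReal.ofReal (meanShellConst F) := hGm


/-- The scaled density `r ↦ ∫_{B₁} r^m φ_μ(r•w) dw` recovers `∫_{B_r} φ_μ` (`r > 0`). [folklore] -/
theorem setLIntegral_gaussDensity_ball_eq {r : ℝ} (hr : 0 < r) (μ : F) :
    ∫⁻ y in ball (0 : F) r, ENNReal.ofReal (gaussDensity μ y) =
      ∫⁻ w in ball (0 : F) 1, ENNReal.ofReal (r ^ finrank ℝ F * gaussDensity μ (r • w)) := by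
  rw [setLIntegral_ball_eq_smul hr]
  refine setLIntegral_congr_fun measurableSet_ball fun w _ => ?_
  rw [ENNReal.ofReal_mul (pow_nonneg hr.le _)]

omit [FiniteDimensional ℝ F] [MeasurableSpace F] [BorelSpace F] in
/-- Joint continuity of `(w, r) ↦ hb(r, w)`. [folklore] -/
theorem continuous_rayBound_uncurry (μ : F) (m : ℕ) :
    Continuous fun p : F × ℝ => rayBound μ p.1 m p.2 := by
  unfold rayBound gaussDensity
  fun_prop

end Shell

end Summit.QuantumFields.BalabanUV.T4Continuum.NE9GaussDensityRay

end
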